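import Mathlib
import Literature.Geometry.Lorentzian.ReggeWheelerChannels
import Literature.Analysis.Calculus.TwoVariablePartials
import Literature.Analysis.PDE.Wave1DFarEnergyLimits
import Summits.FinalStateConjecture.FinalStateConjecture.Theorems.PhotonSphereChannelsUniformPhotonSphereChannelsRKernelOneWedge
import Summits.FinalStateConjecture.FinalStateConjecture.Theorems.PhotonSphereChannelsUniformPhotonSphereChannelsRKernelOneHardy
import Summits.FinalStateConjecture.FinalStateConjecture.Theorems.PhotonSphereChannelsUniformPhotonSphereChannelsRKernelOneGlobalize
import Summits.FinalStateConjecture.FinalStateConjecture.Theorems.PhotonSphereChannelsUniformPhotonSphereChannelsRKernelOneCompare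

/-!
# Kernel-one far channels, IX: the global inequality and the registered stub `stub_kernelOneChannels`

Line `crum-peeling-recessive-tower` of crux `UniformPhotonSphereChannelsR`
(stmt-FinalStateConjecture-14074), stub K: for `Q ∈ C¹(a, ∞)`, `Q ≥ 0`, non-increasing on
`[x_f, ∞)` with Hardy size `t² Q(x_f + t) ≤ 1/16`, a finite-energy static solution `u` (`u'' = Qu`,
`u(x_f) ≠ 0`) and a `C²` solution `φ` of `φ_tt − φ_xx + Qφ = 0` on `{x > a}` with finite far energy,
`(1/2) · inf_c E_Q[φ − c u; x > x_f](0) ≤ E⁺_far + E⁻_far`.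

* `kernelOne_global` — the GLOBAL form: for `V ∈ C¹(ℝ)`, `V ≥ 0`, non-increasing on `[x_f, ∞)`
  with Hardy size `≤ 1/16`, and `ψ ∈ C²(ℝ²)` solving `ψ_tt − ψ_xx + Vψ = 0` on `{x ≥ x_f}` with
  finite initial far energy and VANISHING CORNER VALUE `ψ(0, x_f) = 0`:
  `(3/4) E(0) ≤ E⁺ + E⁻`.  The exact ray-flux identities `E(0) − E^± = A^± + B^±`
  (`ray_flux_integrableOn`), the wedge inequality `(A⁺ − B⁺) + (A⁻ − B⁻) ≤ E⁺ + E⁻` (`wedge_le`)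
  and Hardy on the two null rays `B^± ≤ A^±/4` (`hardy_ray`; `hasDerivAt_ray`: the trace
  `x ↦ ψ(x − x_f, x)` has derivative `ψ_t + ψ_x`) combine by linear arithmetic.
* `stub_kernelOneChannels` — globalize by a smooth spatial cutoff `χ` (`…RKernelOneGlobalize`):
  `V = χQ`, `ψ = χ(φ − c₀u)`, `φg = χφ`, `S = c₀χu`, `c₀ = φ(0, x_f)/u(x_f)`, all `C²(ℝ²)`,
  solving the `V`-equation on `{x ≥ x_f}`, `ψ = φg − S`, `ψ(0, x_f) = 0`; `kernelOne_global` gives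
  `(3/4) E[ψ](0) ≤ L⁺[ψ] + L⁻[ψ]`; subtracting the finite-energy static `S` costs at most a factor
  `3/2` on the channel limits (`farLimit_sub_le`, `…RKernelOneCompare`), so
  `(1/2) E[ψ](0) ≤ L⁺[φ] + L⁻[φ]`; finally `E[ψ](0) = E_Q[φ − c₀u](0) ≥ inf_c` and
  `L^±[φ] = farChannelEnergy Q x_f φ` (`ofReal` of convergent real energies).  The short-range
  hypothesis `∫ x Q < ∞` of the stub is not needed.
-/

noncomputable section

-- the doubled `FinalStateConjecture.FinalStateConjecture` path component trips dupNamespace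
set_option linter.dupNamespace false

namespace Summit.FinalStateConjecture.FinalStateConjecture.Theorems.CrumPeelingRecessiveTower

open Literature.Geometry.Lorentzian Literature.Geometry.Lorentzian.ReggeWheeler MeasureTheory Filter
open Set Topology Literature.Analysis.PDE Literature.Analysis.Calculus
open scoped ENNReal

section Global

variable {V : ℝ → ℝ} {ψ : ℝ → ℝ → ℝ} {xf : ℝ}

/-- The trace of a `C²` (indeed `C¹`) function along the outgoing ray `x ↦ (x − x_f, x)` has
derivative `ψ_t + ψ_x` there. -/
theorem hasDerivAt_ray (hψ : ContDiff ℝ 2 (Function.uncurry ψ)) (xf x : ℝ) :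
    HasDerivAt (fun y => ψ (y - xf) y)
      (deriv (fun τ => ψ τ x) (x - xf) + deriv (ψ (x - xf)) x) x := by
  set F : ℝ × ℝ → ℝ := Function.uncurry ψ with hF
  have hFd : Differentiable ℝ F := hψ.differentiable (by norm_num)
  have hγ : HasDerivAt (fun y : ℝ => ((y - xf, y) : ℝ × ℝ)) ((1 : ℝ), (1 : ℝ)) x :=
    ((hasDerivAt_id x).sub_const xf).prodMk (hasDerivAt_id x)
  have hcomp := HasFDerivAt.comp_hasDerivAt (f := fun y : ℝ => ((y - xf, y) : ℝ × ℝ)) x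
    ((hFd (x - xf, x)).hasFDerivAt) hγ
  have e1 : fderiv ℝ F (x - xf, x) ((1 : ℝ), (0 : ℝ)) = deriv (fun τ => ψ τ x) (x - xf) := by
    have hc : HasDerivAt (fun τ : ℝ => ((τ, x) : ℝ × ℝ)) ((1 : ℝ), (0 : ℝ)) (x - xf) :=
      (hasDerivAt_id _).prodMk (hasDerivAt_const _ _)
    exact ((hFd (x - xf, x)).hasFDerivAt.comp_hasDerivAt (x - xf) hc).deriv.symm
  have e2 : fderiv ℝ F (x - xf, x) ((0 : ℝ), (1 : ℝ)) = deriv (ψ (x - xf)) x := by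
    have hc : HasDerivAt (fun y : ℝ => ((x - xf, y) : ℝ × ℝ)) ((0 : ℝ), (1 : ℝ)) x :=
      (hasDerivAt_const _ _).prodMk (hasDerivAt_id _)
    exact ((hFd (x - xf, x)).hasFDerivAt.comp_hasDerivAt x hc).deriv.symm
  have e3 : fderiv ℝ F (x - xf, x) ((1 : ℝ), (1 : ℝ))
      = fderiv ℝ F (x - xf, x) ((1 : ℝ), (0 : ℝ)) + fderiv ℝ F (x - xf, x) ((0 : ℝ), (1 : ℝ)) := by
    rw [← map_add, Prod.mk_add_mk, add_zero, zero_add]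
  rw [e3, e1, e2] at hcomp
  exact hcomp

/-- **The far channel inequality, kernel one, global form.** See the module docstring. -/
theorem kernelOne_global (hV : ContDiff ℝ 1 V) (hV0 : ∀ x, 0 ≤ V x) (hVa : AntitoneOn V (Ici xf))
    (hVK : ∀ t : ℝ, 0 < t → t ^ 2 * V (xf + t) ≤ 1 / 16)
    (hψ : ContDiff ℝ 2 (Function.uncurry ψ))
    (hsol : ∀ τ x, xf ≤ x →
      iteratedDeriv 2 (fun σ => ψ σ x) τ - iteratedDeriv 2 (ψ τ) x + V x * ψ τ x = 0)
    (hfin : ∫⁻ x in Ioi xf, ENNReal.ofReal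
      (deriv (fun τ => ψ τ x) 0 ^ 2 + deriv (ψ 0) x ^ 2 + V x * ψ 0 x ^ 2) < ⊤)
    (h0 : ψ 0 xf = 0) {Lp Lm : ℝ}
    (hLp : Tendsto (fun t => ∫ x in Ioi (xf + |t|),
      (deriv (fun τ => ψ τ x) t ^ 2 + deriv (ψ t) x ^ 2 + V x * ψ t x ^ 2)) atTop (𝓝 Lp))
    (hLm : Tendsto (fun t => ∫ x in Ioi (xf + |t|),
      (deriv (fun τ => ψ τ x) t ^ 2 + deriv (ψ t) x ^ 2 + V x * ψ t x ^ 2)) atBot (𝓝 Lm)) :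
    3 / 4 * (∫ x in Ioi xf, (deriv (fun τ => ψ τ x) 0 ^ 2 + deriv (ψ 0) x ^ 2 + V x * ψ 0 x ^ 2))
      ≤ Lp + Lm := by
  have hVc : Continuous V := hV.continuous
  have hVK' : ∀ x, xf < x → (x - xf) ^ 2 * V x ≤ 1 / 16 := by
    intro x hx
    have h := hVK (x - xf) (by linarith)
    rwa [show xf + (x - xf) = x by ring] at h
  -- the time-reversed solution
  set ψr : ℝ → ℝ → ℝ := fun t x => ψ (-t) x with hψr
  obtain ⟨hψrC, hsolr, hert, hψr0, -⟩ := timeReversal_halfPlane hψ hsol hψr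
  have her0 : ∀ x, deriv (fun τ => ψr τ x) 0 ^ 2 + deriv (ψr 0) x ^ 2 + V x * ψr 0 x ^ 2
      = deriv (fun τ => ψ τ x) 0 ^ 2 + deriv (ψ 0) x ^ 2 + V x * ψ 0 x ^ 2 := by
    intro x; rw [hert 0 x, neg_zero]
  have hfinr : ∫⁻ x in Ioi xf, ENNReal.ofReal
      (deriv (fun τ => ψr τ x) 0 ^ 2 + deriv (ψr 0) x ^ 2 + V x * ψr 0 x ^ 2) < ⊤ := by
    simp only [her0]; exact hfin
  have hE0r : (∫ x in Ioi xf, (deriv (fun τ => ψr τ x) 0 ^ 2 + deriv (ψr 0) x ^ 2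
      + V x * ψr 0 x ^ 2))
      = ∫ x in Ioi xf, (deriv (fun τ => ψ τ x) 0 ^ 2 + deriv (ψ 0) x ^ 2 + V x * ψ 0 x ^ 2) := by
    simp only [her0]
  have hLpr : Tendsto (fun t => ∫ x in Ioi (xf + |t|),
      (deriv (fun τ => ψr τ x) t ^ 2 + deriv (ψr t) x ^ 2 + V x * ψr t x ^ 2)) atTop (𝓝 Lm) := by
    refine (hLm.comp tendsto_neg_atTop_atBot).congr fun t => ?_
    simp only [Function.comp, hert, abs_neg]
  -- ray fluxes, wedge
  obtain ⟨hiA, hiB, hAB⟩ := ray_flux_integrableOn hVc hV0 hψ hsol hfin hLp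
  obtain ⟨hiAr, hiBr, hABr⟩ := ray_flux_integrableOn hVc hV0 hψrC hsolr hfinr hLpr
  rw [hE0r] at hABr
  have hW := wedge_le hV hV0 hVa hψ hsol hfin hψr hLp hLm
  -- Hardy on the two rays
  have hHardy : ∀ (φ : ℝ → ℝ → ℝ), ContDiff ℝ 2 (Function.uncurry φ) → φ 0 xf = 0 →
      IntegrableOn (fun x => (deriv (fun τ => φ τ x) (x - xf) + deriv (φ (x - xf)) x) ^ 2) (Ioi xf) →
      IntegrableOn (fun x => V x * φ (x - xf) x ^ 2) (Ioi xf) →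
      (∫ x in Ioi xf, V x * φ (x - xf) x ^ 2)
        ≤ 4 * (1 / 16) * ∫ x in Ioi xf,
          (deriv (fun τ => φ τ x) (x - xf) + deriv (φ (x - xf)) x) ^ 2 := by
    intro φ hφ hφ0 hiA' hiB'
    obtain ⟨φt, φx, -, -, -, hct, hcx, -, -, -, h1, h2, -⟩ := exists_partials_of_contDiff_two hφ
    have hray : Continuous fun x : ℝ => ((x - xf, x) : ℝ × ℝ) :=
      (continuous_id.sub continuous_const).prodMk continuous_id
    have hf'c : Continuous fun x => deriv (fun τ => φ τ x) (x - xf) + deriv (φ (x - xf)) x := by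
      have : (fun x => deriv (fun τ => φ τ x) (x - xf) + deriv (φ (x - xf)) x)
          = fun x => φt (x - xf) x + φx (x - xf) x := by
        funext x; rw [(h1 (x - xf) x).deriv, (h2 (x - xf) x).deriv]
      rw [this]
      exact (hct.comp hray).add (hcx.comp hray)
    exact hardy_ray (f := fun y => φ (y - xf) y) hVc hV0 hVK' (hasDerivAt_ray hφ xf) hf'c
      (by simp [hφ0]) hiA' hiB'
  have hH := hHardy ψ hψ h0 hiA hiB
  have hHr := hHardy ψr hψrC (by simp [hψr, h0]) hiAr hiBr
  -- positivity of the fluxes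
  have hA0 : 0 ≤ ∫ x in Ioi xf, (deriv (fun τ => ψ τ x) (x - xf) + deriv (ψ (x - xf)) x) ^ 2 :=
    setIntegral_nonneg measurableSet_Ioi fun x _ => sq_nonneg _
  have hAr0 : 0 ≤ ∫ x in Ioi xf, (deriv (fun τ => ψr τ x) (x - xf) + deriv (ψr (x - xf)) x) ^ 2 :=
    setIntegral_nonneg measurableSet_Ioi fun x _ => sq_nonneg _
  have hB0 : 0 ≤ ∫ x in Ioi xf, V x * ψ (x - xf) x ^ 2 :=
    setIntegral_nonneg measurableSet_Ioi fun x _ => mul_nonneg (hV0 x) (sq_nonneg _)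
  have hBr0 : 0 ≤ ∫ x in Ioi xf, V x * ψr (x - xf) x ^ 2 :=
    setIntegral_nonneg measurableSet_Ioi fun x _ => mul_nonneg (hV0 x) (sq_nonneg _)
  -- linear arithmetic
  nlinarith [hAB, hABr, hW, hH, hHr, hA0, hAr0, hB0, hBr0]

end Global

/-- **Stub K — kernel-one far channels for a sub-Hardy potential** (registered statement of the
skeleton of line `crum-peeling-recessive-tower`; see the module docstring for the proof). -/
theorem stub_kernelOneChannels :
    ∀ (Q : ℝ → ℝ) (a xf : ℝ), a < xf → ContDiffOn ℝ 1 Q (Set.Ioi a) → (∀ x, a < x → 0 ≤ Q x) →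
      AntitoneOn Q (Set.Ici xf) → IntegrableOn (fun x => x * Q x) (Set.Ioi xf) →
      (∀ t : ℝ, 0 < t → t ^ 2 * Q (xf + t) ≤ 1 / 16) →
      ∀ u : ℝ → ℝ, ContDiffOn ℝ 2 u (Set.Ioi a) →
        (∀ x, a < x → iteratedDeriv 2 u x = Q x * u x) →
        (∫⁻ x in Set.Ioi xf, ENNReal.ofReal (deriv u x ^ 2 + Q x * u x ^ 2)) ≠ ⊤ → u xf ≠ 0 →
        ∀ φ : ℝ → ℝ → ℝ, ContDiffOn ℝ 2 (Function.uncurry φ) {z : ℝ × ℝ | a < z.2} →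
          (∀ z : ℝ × ℝ, a < z.2 → IsSolutionAt Q φ z) → farEnergy Q xf φ 0 ≠ ⊤ →
          ENNReal.ofReal (1 / 2) *
              (⨅ c : ℝ, ∫⁻ x in Set.Ioi xf,
                ENNReal.ofReal (energyDensity Q (fun t y => φ t y - c * u y) 0 x))
            ≤ farChannelEnergy Q xf φ atTop + farChannelEnergy Q xf φ atBot := by
  intro Q a xf hxf hQ1 hQ0 hQa _hQi hQK u hu2 hueq hufin huxf φ hφ2 hφsol hφfin
  -- the cutoff and the globalized potential
  obtain ⟨χ, a₁, a₂, ha₁, h12, h2f, hχ, hχ0, hχ1, hχnn⟩ := exists_cutoff hxf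
  have ha₂ : a < a₂ := by linarith
  set V : ℝ → ℝ := fun x => χ x * Q x with hVdef
  have hVC : ContDiff ℝ 1 V := contDiff_cutoff_mul hχ hχ0 ha₁ hQ1
  have hVc : Continuous V := hVC.continuous
  have hVQ : ∀ x, a₂ ≤ x → V x = Q x := fun x hx => by simp [hVdef, hχ1 x hx]
  have hV0 : ∀ x, 0 ≤ V x := by
    intro x
    rcases lt_or_ge a x with hx | hx
    · exact mul_nonneg (hχnn x) (hQ0 x hx)
    · simp [hVdef, hχ0 x (by linarith)]
  have hVa : AntitoneOn V (Ici xf) := by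
    intro x hx y hy hxy
    have hx' : xf ≤ x := hx
    have hy' : xf ≤ y := hy
    rw [hVQ x (by linarith), hVQ y (by linarith)]
    exact hQa hx hy hxy
  have hVK : ∀ t : ℝ, 0 < t → t ^ 2 * V (xf + t) ≤ 1 / 16 := fun t ht => by
    rw [hVQ (xf + t) (by linarith)]; exact hQK t ht
  -- the constant and the globalized functions
  set c₀ : ℝ := φ 0 xf / u xf with hc₀
  set φ₁ : ℝ → ℝ → ℝ := fun t y => φ t y - c₀ * u y with hφ₁
  set gS : ℝ → ℝ → ℝ := fun _ y => c₀ * u y with hgS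
  set ψ : ℝ → ℝ → ℝ := fun t x => χ x * φ₁ t x with hψ
  set φg : ℝ → ℝ → ℝ := fun t x => χ x * φ t x with hφg
  set S : ℝ → ℝ → ℝ := fun t x => χ x * gS t x with hS
  have hψdef : ψ = fun t x => φg t x - S t x := by
    funext t x; simp only [hψ, hφg, hS, hφ₁, hgS]; ring
  have hstat : ∀ t x, S t x = S 0 x := fun t x => rfl
  -- regularity and the equation on the half-plane `{x ≥ xf}`
  have hφ₁2 : ContDiffOn ℝ 2 (Function.uncurry φ₁) {z : ℝ × ℝ | a < z.2} :=
    contDiffOn_sub_static hφ2 hu2 c₀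
  have hφ₁sol : ∀ z : ℝ × ℝ, a < z.2 → IsSolutionAt Q φ₁ z :=
    isSolutionAt_sub_static hφ2 hφsol hu2 hueq c₀
  have hgS2 : ContDiffOn ℝ 2 (Function.uncurry gS) {z : ℝ × ℝ | a < z.2} := contDiffOn_static hu2 c₀
  have hgSsol : ∀ z : ℝ × ℝ, a < z.2 → IsSolutionAt Q gS z := isSolutionAt_static hueq c₀
  have hψC : ContDiff ℝ 2 (Function.uncurry ψ) := contDiff_glob hχ hχ0 ha₁ hφ₁2
  have hφgC : ContDiff ℝ 2 (Function.uncurry φg) := contDiff_glob hχ hχ0 ha₁ hφ2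
  have hSC : ContDiff ℝ 2 (Function.uncurry S) := contDiff_glob hχ hχ0 ha₁ hgS2
  have hψsol : ∀ τ x, xf ≤ x →
      iteratedDeriv 2 (fun σ => ψ σ x) τ - iteratedDeriv 2 (ψ τ) x + V x * ψ τ x = 0 :=
    fun τ x hx => glob_residual hχ1 (fun z hz => hφ₁sol z (ha₂.trans hz)) τ x (h2f.trans_le hx)
  have hφgsol : ∀ τ x, xf ≤ x →
      iteratedDeriv 2 (fun σ => φg σ x) τ - iteratedDeriv 2 (φg τ) x + V x * φg τ x = 0 :=
    fun τ x hx => glob_residual hχ1 (fun z hz => hφsol z (ha₂.trans hz)) τ x (h2f.trans_le hx)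
  have hSsol : ∀ τ x, xf ≤ x →
      iteratedDeriv 2 (fun σ => S σ x) τ - iteratedDeriv 2 (S τ) x + V x * S τ x = 0 :=
    fun τ x hx => glob_residual hχ1 (fun z hz => hgSsol z (ha₂.trans hz)) τ x (h2f.trans_le hx)
  -- energy densities on the far region
  have hψe : ∀ t x, a₂ < x → deriv (fun τ => ψ τ x) t ^ 2 + deriv (ψ t) x ^ 2 + V x * ψ t x ^ 2
      = energyDensity Q φ₁ t x := fun t x hx => glob_energyDensity hχ1 φ₁ t x hx
  have hφge : ∀ t x, a₂ < x → deriv (fun τ => φg τ x) t ^ 2 + deriv (φg t) x ^ 2 + V x * φg t x ^ 2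
      = energyDensity Q φ t x := fun t x hx => glob_energyDensity hχ1 φ t x hx
  have hSe : ∀ t x, a₂ < x → deriv (fun τ => S τ x) t ^ 2 + deriv (S t) x ^ 2 + V x * S t x ^ 2
      = c₀ ^ 2 * (deriv u x ^ 2 + Q x * u x ^ 2) := by
    intro t x hx
    rw [show deriv (fun τ => S τ x) t ^ 2 + deriv (S t) x ^ 2 + V x * S t x ^ 2
      = energyDensity Q gS t x from glob_energyDensity hχ1 gS t x hx]
    simp only [energyDensity, hgS, deriv_const, deriv_const_mul_field']
    ring
  -- finiteness of the initial far energies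
  have hφgfin : ∫⁻ x in Ioi xf, ENNReal.ofReal
      (deriv (fun τ => φg τ x) 0 ^ 2 + deriv (φg 0) x ^ 2 + V x * φg 0 x ^ 2) < ⊤ := by
    have h : farEnergy Q xf φ 0 = ∫⁻ x in Ioi xf, ENNReal.ofReal
        (deriv (fun τ => φg τ x) 0 ^ 2 + deriv (φg 0) x ^ 2 + V x * φg 0 x ^ 2) := by
      unfold farEnergy
      rw [show {x : ℝ | xf + |(0 : ℝ)| < x} = Ioi xf by ext x; simp]
      exact setLIntegral_congr_fun measurableSet_Ioi fun x hx => by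
        rw [hφge 0 x (h2f.trans hx)]
    rw [← h]
    exact lt_top_iff_ne_top.2 hφfin
  have hSfin : ∫⁻ x in Ioi xf, ENNReal.ofReal
      (deriv (fun τ => S τ x) 0 ^ 2 + deriv (S 0) x ^ 2 + V x * S 0 x ^ 2) < ⊤ := by
    have h : (∫⁻ x in Ioi xf, ENNReal.ofReal
        (deriv (fun τ => S τ x) 0 ^ 2 + deriv (S 0) x ^ 2 + V x * S 0 x ^ 2))
        = ENNReal.ofReal (c₀ ^ 2) * ∫⁻ x in Ioi xf, ENNReal.ofReal (deriv u x ^ 2 + Q x * u x ^ 2) := by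
      rw [← lintegral_const_mul' _ _ ENNReal.ofReal_ne_top]
      exact setLIntegral_congr_fun measurableSet_Ioi fun x hx => by
        rw [hSe 0 x (h2f.trans hx), ENNReal.ofReal_mul (sq_nonneg _)]
    rw [h]
    exact ENNReal.mul_lt_top ENNReal.ofReal_lt_top (lt_top_iff_ne_top.2 hufin)
  have hψfin := lintegral_energy_sub_lt_top (xf := xf) hVc hV0 hφgC hSC hψdef hφgfin hSfin
  -- limits of the far energies
  obtain ⟨Lp, Lm, -, -, -, -, hLp, hLm⟩ := wave1D_exists_farEnergy_limits hVc hV0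
    (continuous_residual hVc hψC) hψC (fun t x => rfl) hψsol hψfin
  obtain ⟨Mp, Mm, hMp0, hMm0, -, -, hMp, hMm⟩ := wave1D_exists_farEnergy_limits hVc hV0
    (continuous_residual hVc hφgC) hφgC (fun t x => rfl) hφgsol hφgfin
  -- the kernel-one inequality for `ψ` and the comparison of the limits
  have hψ0 : ψ 0 xf = 0 := by
    simp only [hψ, hφ₁, hc₀, hχ1 xf h2f.le, div_mul_cancel₀ _ huxf]
    ring
  have hmain := kernelOne_global hVC hV0 hVa hVK hψC hψsol hψfin hψ0 hLp hLm
  have hcp := farLimit_sub_le hVc hV0 hφgC hφgsol hφgfin hSC hSsol hSfin hstat hψdef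
    tendsto_abs_atTop_atTop hLp hMp
  have hcm := farLimit_sub_le hVc hV0 hφgC hφgsol hφgfin hSC hSsol hSfin hstat hψdef
    tendsto_abs_atBot_atTop hLm hMm
  -- the initial energy of `ψ` is the `Q`-energy of `φ − c₀ u` beyond `xf`
  set E0 : ℝ := ∫ x in Ioi xf, (deriv (fun τ => ψ τ x) 0 ^ 2 + deriv (ψ 0) x ^ 2 + V x * ψ 0 x ^ 2)
    with hE0
  have hE0' : ENNReal.ofReal E0 = ∫⁻ x in Ioi xf, ENNReal.ofReal
      (deriv (fun τ => ψ τ x) 0 ^ 2 + deriv (ψ 0) x ^ 2 + V x * ψ 0 x ^ 2) := by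
    have h := (wave1D_farEnergy_integrableOn hVc hV0 (continuous_residual hVc hψC) hψC
      (fun t x => rfl) hψsol hψfin 0).2
    simpa using h
  have hinf : (⨅ c : ℝ, ∫⁻ x in Ioi xf,
      ENNReal.ofReal (energyDensity Q (fun t y => φ t y - c * u y) 0 x)) ≤ ENNReal.ofReal E0 := by
    refine (iInf_le _ c₀).trans (le_of_eq ?_)
    rw [hE0']
    exact setLIntegral_congr_fun measurableSet_Ioi fun x hx => by rw [hψe 0 x (h2f.trans hx)]
  -- the far channel energies of `φ` are `ofReal` of the limits `Mp`, `Mm`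
  have hfe : farEnergy Q xf φ = fun t => ENNReal.ofReal (∫ x in Ioi (xf + |t|),
      (deriv (fun τ => φg τ x) t ^ 2 + deriv (φg t) x ^ 2 + V x * φg t x ^ 2)) := by
    funext t
    rw [(wave1D_farEnergy_integrableOn hVc hV0 (continuous_residual hVc hφgC) hφgC
      (fun t x => rfl) hφgsol hφgfin t).2]
    unfold farEnergy
    exact setLIntegral_congr_fun measurableSet_Ioi fun x hx => by
      have hx' : xf + |t| < x := hx
      rw [hφge t x (by linarith [abs_nonneg t])]
  have hcTop : farChannelEnergy Q xf φ atTop = ENNReal.ofReal Mp := by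
    unfold farChannelEnergy; rw [hfe]
    exact ((ENNReal.continuous_ofReal.tendsto Mp).comp hMp).liminf_eq
  have hcBot : farChannelEnergy Q xf φ atBot = ENNReal.ofReal Mm := by
    unfold farChannelEnergy; rw [hfe]
    exact ((ENNReal.continuous_ofReal.tendsto Mm).comp hMm).liminf_eq
  -- conclusion
  have hE0nn : 0 ≤ E0 := setIntegral_nonneg measurableSet_Ioi fun x _ =>
    wave1D_energyDensity_nonneg hV0 0 x
  have hfinal : E0 / 2 ≤ Mp + Mm := by linarith
  rw [hcTop, hcBot, ← ENNReal.ofReal_add hMp0 hMm0]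
  calc ENNReal.ofReal (1 / 2) * (⨅ c : ℝ, ∫⁻ x in Ioi xf,
        ENNReal.ofReal (energyDensity Q (fun t y => φ t y - c * u y) 0 x))
      ≤ ENNReal.ofReal (1 / 2) * ENNReal.ofReal E0 := by gcongr
    _ = ENNReal.ofReal (E0 / 2) := by rw [← ENNReal.ofReal_mul (by norm_num)]; ring_nf
    _ ≤ ENNReal.ofReal (Mp + Mm) := ENNReal.ofReal_le_ofReal hfinal

end Summit.FinalStateConjecture.FinalStateConjecture.Theorems.CrumPeelingRecessiveTower
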